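import Summits.HodgeConjecture.HodgeConjecture.Theorems.F0P6aPELWitnessEStubs   -- ★ PART A of the same Lines workfile (size-lint split; same namespace `Summit.HodgeConjecture.HodgeConjecture.Cruxes.HLiu418.F0P6aPELWitnessE`)
import HarnessLib

/-!
# ★ RE-HOME — PART B (size lint: `Theorems/` files with proofs are ≤ 400 lines) of the Lines workfile whose PART A is `Theorems/F0P6aPELWitnessEStubs.lean`.

Same namespace `Summit.HodgeConjecture.HodgeConjecture.Cruxes.HLiu418.F0P6aPELWitnessE` (every fully-qualified name unchanged); the preamble (options, `noncomputable section`, top-level `open`s) is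
repeated verbatim from Part A; the code below is the remainder of the tree bytes, untouched.  See Part A for the ★ re-home header and the original module
docstring.  HC_CM is proved only modulo the 7 printed citations (2 remaining: hLiu418 = stmt-HodgeConjecture-24832, h413 = stmt-HodgeConjecture-24833) until rung 0 closes.
-/


set_option autoImplicit false

noncomputable section

namespace Summit.HodgeConjecture.HodgeConjecture.Cruxes.HLiu418.F0P6aPELWitnessE

set_option linter.dupNamespace false  -- `Summit.HodgeConjecture.HodgeConjecture.…` BY DESIGN (D-0017)

open CategoryTheory CategoryTheory.Limits NumberField IsDedekindDomain MulAction Matrix AlgebraicGeometry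
open scoped Matrix ComplexOrder Polynomial
open Literature.AlgebraicGeometry.Motives (SchemeOver AlgPoints ComplexPoints specOver)
open Literature.AlgebraicGeometry.Motives.AbelianVariety (bcSpec)
open Literature.AlgebraicGeometry.AbelianSchemes (PolarizedAbelianSchemeWithLevel AbelianSchemeOver)
open Literature.AlgebraicGeometry.ModuliOfAbelianVarieties
open Literature.AlgebraicGeometry.ShimuraVarieties Literature.AlgebraicGeometry.ShimuraVarieties.UnitaryCanonicalModel
open Literature.AlgebraicGeometry.HodgeTheory (IsQuasiProjectiveOver)
open Literature.NumberTheory.Automorphic Literature.NumberTheory.Automorphic.UnitaryGroup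
open Literature.NumberTheory.Automorphic.Liu2021.AppendixC (C5.OpenCompactSubgroup C5.SmallLevel C5.HeckeLE)

/-- **`stub_E4` — GAGA ∕ BOREL ON THE COMPACT DISC PIECES** (PAID in ED. 2 by ★ E4; name kept for the registry): the point map of a chart is induced by a morphism of `ℂ`-schemes
`ψ : (S.M Kc) ⊗_{ι₁} ℂ ⟶ 𝓜.M ⊗_ℚ ℂ` (each piece of `(S.M Kc)_ℂ` is a COMPACT disc quotient `Γ_q∖𝔻` — ★ `S.pieces` — on which `f ∘ unif_q = ιc ∘ unif ∘ Z (g_q)`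
is holomorphic, hence algebraic by GAGA ∕ Chow; glue over the cofan).  The rank-1 twin of ★ `SiegelBorelExtensionPiece.exists_hom_of_holomorphicSiegelLift`.
[cite: Borel1972ExtensionTheorem, Thm. 3.10 p. 559] [cite: Milne2005ShimuraVarieties, Thm. 3.14 and Thm. 5.16] [cite: Mumford1981, §4B (4.14) p. 67] -/
theorem stub_E4 : ∀ (F : Type) [Field F] [NumberField F] [IsCMField F] [IsGalois ℚ F] (ι₁ : F →+* ℂ)
    (Jstar : Matrix (Fin 2) (Fin 2) F) (_hJ : (Jstar.map (IsCMField.complexConj F))ᵀ = Jstar) (_hJu : IsUnit Jstar)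
    (K₀ : C5.OpenCompactSubgroup (GSAdele F Jstar)) (S : RecordSystemGS F Jstar ι₁ K₀) (Kc : C5.SmallLevel K₀)
    (Fi : Type) [Field Fi] [NumberField Fi] [Algebra F Fi] (τE : Fi →+* ℂ) (_hτE : τE.comp (algebraMap F Fi) = ι₁)
    (Φ : Set (F →+* ℂ)) (C : AuxChartGS F ι₁ Jstar K₀ S Kc Fi τE Φ),
    letI : Algebra F ℂ := ι₁.toAlgebra
    ∃ ψ : (Literature.AlgebraicGeometry.Motives.baseChangeHom ι₁).obj (S.M.obj Kc) ⟶
        (Literature.AlgebraicGeometry.Motives.baseChange ℚ ℂ).obj C.𝓜.M,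
      ∀ P : ComplexPoints (S.M.obj Kc),
        (AlgPoints.map ψ (AlgPoints.baseChangeEquiv ι₁ (S.M.obj Kc) P)).left ≫
            Literature.AlgebraicGeometry.Motives.baseChangeHomFst (algebraMap ℚ ℂ) C.𝓜.M =
          (C.f (S.pts Kc P)).left := by
  -- PAID (ED. 2): ★ E4 `RecordSystemGS.exists_hom_of_holomorphicSiegelLifts` (A-p14 (g33), p846949) through the field `unif_cont` (TIE cca6250f)
  intro F _ _ _ _ ι₁ Jstar _ _ K₀ S Kc Fi _ _ _ τE _ Φ C
  haveI := C.smooth_M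
  exact S.exists_hom_of_holomorphicSiegelLifts Kc C.𝓜.M C.quasiProjective_M C.Sc C.ιc C.unif C.unif_cont C.unif_hol C.f C.piece C.Z
    C.Z_hol C.Z_mem C.f_mk

/-- **`stub_E5` — DESCENT TO THE SLICE FIELD** (PAID in ED. 2 by ★ E5; name kept for the registry) ([Milne2005ShimuraVarieties] Prop. 13.1 pattern, ★ `RecordSystemGS.embeddingDefinedOver_of_complex`):
a `ℂ`-morphism inducing the chart՚s point map descends to an `Fᵢ`-morphism `ε : (S.M Kc) ⊗_F Fᵢ ⟶ 𝓜.M ⊗_ℚ Fᵢ` inducing it (source reduced — smooth —,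
target separated — quasi-projective —, Galois-conjugates of `ψ` agree at the dense CM points by the record՚s (F3) `recip` and the chart՚s `f_recip`).
«Inducing»: for a complex point `P` of `X` along `τE` read as the `F`-point `P♭` of `S.M Kc` (`P♭.left = P.left ≫ pr₁`), `ε ∘ P` lies over `f (pts P♭)`.
[cite: Milne2005ShimuraVarieties, Prop. 13.1 p. 117, Thm. 13.7 and Rem. 13.8 p. 119] [cite: Deligne1979ShimuraVarieties, 2.2.6 and Cor. 2.7.21] -/
theorem stub_E5 : ∀ (F : Type) [Field F] [NumberField F] [IsCMField F] [IsGalois ℚ F] (ι₁ : F →+* ℂ)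
    (Jstar : Matrix (Fin 2) (Fin 2) F) (_hJ : (Jstar.map (IsCMField.complexConj F))ᵀ = Jstar) (_hJu : IsUnit Jstar)
    (K₀ : C5.OpenCompactSubgroup (GSAdele F Jstar)) (S : RecordSystemGS F Jstar ι₁ K₀) (Kc : C5.SmallLevel K₀)
    (Fi : Type) [Field Fi] [NumberField Fi] [Algebra F Fi] [IsGalois F Fi] (τE : Fi →+* ℂ) (_hτE : τE.comp (algebraMap F Fi) = ι₁)
    (Φ : Set (F →+* ℂ)) (C : AuxChartGS F ι₁ Jstar K₀ S Kc Fi τE Φ),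
    (letI : Algebra F ℂ := ι₁.toAlgebra
     ∃ ψ : (Literature.AlgebraicGeometry.Motives.baseChangeHom ι₁).obj (S.M.obj Kc) ⟶
        (Literature.AlgebraicGeometry.Motives.baseChange ℚ ℂ).obj C.𝓜.M,
      ∀ P : ComplexPoints (S.M.obj Kc),
        (AlgPoints.map ψ (AlgPoints.baseChangeEquiv ι₁ (S.M.obj Kc) P)).left ≫
            Literature.AlgebraicGeometry.Motives.baseChangeHomFst (algebraMap ℚ ℂ) C.𝓜.M =
          (C.f (S.pts Kc P)).left) →
    letI : Algebra Fi ℂ := τE.toAlgebra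
    ∃ ε : (Literature.AlgebraicGeometry.Motives.baseChange F Fi).obj (S.M.obj Kc) ⟶
        (Literature.AlgebraicGeometry.Motives.baseChange ℚ Fi).obj C.𝓜.M,
      ∀ (P : ComplexPoints ((Literature.AlgebraicGeometry.Motives.baseChange F Fi).obj (S.M.obj Kc)))
        (Pflat : letI : Algebra F ℂ := ι₁.toAlgebra; ComplexPoints (S.M.obj Kc)),
        Pflat.left = P.left ≫ pullback.fst (S.M.obj Kc).hom (bcSpec F Fi) →
        (AlgPoints.map ε P).left ≫ pullback.fst C.𝓜.M.hom (bcSpec ℚ Fi) =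
          (letI : Algebra F ℂ := ι₁.toAlgebra; (C.f (S.pts Kc Pflat)).left) := by
  -- PAID (ED. 2): ★ E5 `RecordSystemGS.exists_sliceDescent_of_complex` (A-p15 (g18), junction 6e0fd62b)
  intro F _ _ _ _ ι₁ Jstar hJ hJu K₀ S Kc Fi _ _ _ _ τE hτE Φ C hψ
  haveI : IsSeparated C.𝓜.M.hom := IsQuasiProjectiveOver.hom_isSeparated C.quasiProjective_M
  exact RecordSystemGS.exists_sliceDescent_of_complex S Kc C.𝓜.M C.f τE C.f_recip hτE hJ hJu hψ

/-- **`stub_E6` — THE PEL TUPLE AND ITS `𝒪_F`-ACTION ON THE RECORD CURVE** — **CLOSED BY NAME in ED. 5 (LEAD «M-65» (b)) by the L6 closer leaf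
`Lines/F0_P6a_StubE6.lean` (`F0P6aStubE6.stub_E6_of_line`, A-p06 (g33∕g34), SORRY-FREE: Σ-AN ★ `readsCReading_of_junction` p848496 + the Σ-GAL leaf
`Lines/F0_P6a_SigmaGAL.lean` (A-p04 (g24) ∕ A-p15 (g19); `stub_KCM` paid by LA6-p01 over `C.cm_recip`∕`C.bq_comm_ρ₀`∕`C.Mρ_frame` + ★ ONE-CALL p848183) + organs
★ G2a∕G2b-α∕H0∕H1∕B-γ∕glue∕KERNEL (LA6-p01∕p02∕p03)); both leaves import the Defs layer only; registered name and statement kept** (ED. 2 THREADS the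
printed letter `hU : siegelUniversalFamilyUniformisation` — o-16 cure (T): the head feeds `stub_UNIVFAM`): along a slice morphism `ε` inducing the chart՚s point map, the
pull-back `P := ε^* 𝓜.univ` of the universal Siegel triple (★ `IsBaseChangeVia`; the pull-back EXISTS: ★ `LevelStructure.baseChange`,
`DualPair.baseChange`, `Polarization.baseChange`) carries an `𝒪_F`-action `ρ` with ROSATI and KOTTWITZ AT `ℂ`-POINTS of signature `mOf ι₁ Φ`
— at each complex point the chart՚s `Mρ a b` is an integral, period-linear matrix (`Mρ_kottwitz`), hence an endomorphism of the marked fibre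
(`f_admissible` + ★ `SiegelAdelicMarking` analytification + GAGA on the fibre); globalisation over `X` by GAGA on `A → X_ℂ` (projective) + rigidity
descent to `Fᵢ`, OR by the finite-étale-section road on the relative `End`-scheme (census by the E6 hand).  The ONE genuinely new organ of the line.
[cite: Kottwitz1992, §5 pp. 389–391] [cite: RapoportSmithlingZhang2020Diagonal, §4.1 p. 17] [cite: MumfordFogartyKirwan1994, Ch. 7 §2 Definition 7.2 (p. 129)] -/
theorem stub_E6 : ∀ (F : Type) [Field F] [NumberField F] [IsCMField F] [IsGalois ℚ F] (ι₁ : F →+* ℂ)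
    (Jstar : Matrix (Fin 2) (Fin 2) F) (_hJ : (Jstar.map (IsCMField.complexConj F))ᵀ = Jstar) (_hJu : IsUnit Jstar)
    (K₀ : C5.OpenCompactSubgroup (GSAdele F Jstar)) (S : RecordSystemGS F Jstar ι₁ K₀) (Kc : C5.SmallLevel K₀)
    (Fi : Type) [Field Fi] [NumberField Fi] [Algebra F Fi] [IsGalois F Fi] (τE : Fi →+* ℂ) (_hτE : τE.comp (algebraMap F Fi) = ι₁)
    (Φ : Set (F →+* ℂ)) (_hΦ : IsCMTypeThrough ι₁ Φ) (C : AuxChartGS F ι₁ Jstar K₀ S Kc Fi τE Φ)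
    (ε : (Literature.AlgebraicGeometry.Motives.baseChange F Fi).obj (S.M.obj Kc) ⟶
        (Literature.AlgebraicGeometry.Motives.baseChange ℚ Fi).obj C.𝓜.M)
    (_hε : letI : Algebra Fi ℂ := τE.toAlgebra
      ∀ (P : ComplexPoints ((Literature.AlgebraicGeometry.Motives.baseChange F Fi).obj (S.M.obj Kc)))
        (Pflat : letI : Algebra F ℂ := ι₁.toAlgebra; ComplexPoints (S.M.obj Kc)),
        Pflat.left = P.left ≫ pullback.fst (S.M.obj Kc).hom (bcSpec F Fi) →
        (AlgPoints.map ε P).left ≫ pullback.fst C.𝓜.M.hom (bcSpec ℚ Fi) =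
          (letI : Algebra F ℂ := ι₁.toAlgebra; (C.f (S.pts Kc Pflat)).left))
    (_hU : Literature.AlgebraicGeometry.ModuliOfAbelianVarieties.siegelUniversalFamilyUniformisation),
    ∃ (P : PolarizedAbelianSchemeWithLevel C.g C.N C.δ ((Literature.AlgebraicGeometry.Motives.baseChange F Fi).obj (S.M.obj Kc)).left)
      (G : P.A.X.left ⟶ C.𝓜.univ.A.X.left) (Ĝ : P.D.hat.X.left ⟶ C.𝓜.univ.D.hat.X.left)
      (_ : P.IsBaseChangeVia C.𝓜.univ (ε.left ≫ pullback.fst C.𝓜.M.hom (bcSpec ℚ Fi)) G Ĝ)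
      (ρ : AbelianSchemeOver.RingAction (𝓞 F) P.A),
      (∀ (b b' : 𝓞 F), (b' : F) = (IsCMField.complexConj F) (b : F) →
          haveI := ρ.isMonHom b
          ρ.i b' ≫ P.pol.lam = P.pol.lam ≫ AbelianSchemeOver.DualPair.dualIsogenyOver (ρ.i b) P.D P.D) ∧
      (letI : Algebra Fi ℂ := τE.toAlgebra
       ∀ (x : ComplexPoints ((Literature.AlgebraicGeometry.Motives.baseChange F Fi).obj (S.M.obj Kc))) (b : 𝓞 F),
        haveI := ρ.isMonHom b
        (Literature.AlgebraicGeometry.Motives.AbelianVariety.cotangentMap (P.A.fibre x.left).toAbelianVariety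
            (AbelianSchemeOver.fibreHom (ρ.i b) x.left)).charpoly =
          ∏ φ : F →+* ℂ, (Polynomial.X - Polynomial.C (φ (b : F))) ^ (mOf ι₁ Φ φ)) :=
  Summit.HodgeConjecture.HodgeConjecture.Cruxes.HLiu418.F0P6aStubE6.stub_E6_of_line

/-! `stub_UNIVFAM` — NOT RESTATED IN THE ★ RE-HOME: its statement `siegelUniversalFamilyUniformisation` is, token for token, that of the
already-landed ★ p849986 `Literature.AlgebraicGeometry.ModuliOfAbelianVarieties.siegelUniversalFamilyUniformisation_holds`
(gate `dedup.landed` rule); the head below consumes that declaration by its full name (the same switch E-LINE ED. 6 makes in the `Lines/` original). -/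

/-! ### §4 HEAD: the line closes the socket modulo the stubs -/

/-- **HEAD `pelWitnessE_of_line` (ED. 5 «N-PARAMETRIC + SEP AT SATURATED LEVEL», LEAD F0P6-plan (g3) «M-52») — THE E-LINE DELIVERS THE PEL TUPLE WITH
`sep` ON THE THICKENED RECORD CURVE AT EVERY SUFFICIENTLY DEEP `b`-SATURATED SMALL LEVEL BELOW `Kc`** (modulo `stub_SIG stub_E123 stub_E6 stub_UNIVFAM`,
all in its cone by name; `stub_E4`∕`stub_E5` PAID): for every letter context (record `S`, `J⋆` hermitian and invertible, small level `Kc`) and every CM type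
`Φ ∋ ι₁` there are a Hodge-embedding `b : U(J⋆)(𝔸_{F⁺,f}) → GSp_δ(𝔸_f)` (continuous, `b(Kc) ⊆ K_δ(1)` — so every `Kc ⊓ b⁻¹K_δ(N)` is a small level NORMAL in `Kc`,
★ `UnitaryCurve.isOpen∕isCompact_inf_comap_principalLevelSubgroup`; normality `C5.HeckeLE u Kc'' Kc''` for `u ∈ Kc` is EXPORTED, ★ `principalLevelSubgroup_normal_in_one`)
and `k₀` such that for EVERY `k ≥ k₀` and the level `Kc'' = Kc ⊓ b⁻¹K_δ(3(k+1)!)` there is a slice field `Fᵢ₀ ∕ F` (finite Galois, `τ₀` extending `ι₁`) with, over EVERY slice field `Fᵢ ⊇ Fᵢ₀` (`τE ∘ j = τ₀`):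
`Nonempty (PELWitnessE … Kc'' Fi τE Φ)` — carrying `sep` (★ p847628 Deligne 1.15 at principal level ⇒ `C.f_injective` ⇒ ★ p847435) and the provenance
`(𝓜, ε, G, Ĝ, isBaseChange)` of `stub_E6`՚s pull-back.  Composition: chart (E123) ↦ `ψ` over `ℂ` (E4) ↦ `ε` over `Fᵢ` (E5) ↦ `(P, ρ)` with Rosati + Kottwitz (E6).
Sorry-free given the stubs.  GEN՚s use in `stub_RGD`∕`stub_SPREAD`: `Kc := Kc ⊓ b⁻¹K_δ(3(k₀+1)!)` (cofinal, normal in the letter՚s `K`), primes `≤ k₀+1` into `S_M`,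
`Fᵢ :=` the compositum of the `Fᵢ₀(Φ)` over the finitely many CM types `Φ` of `F`, one frame `Φ(w)` per place `w`.
[cite: RapoportSmithlingZhang2020Diagonal, §4.1 Thm. 4.1 p. 17] [cite: Deligne1971TravauxShimura, Prop. 1.15 p. 132, 4.16 p. 150] -/
theorem pelWitnessE_of_line (F : Type) [Field F] [NumberField F] [IsCMField F] [IsGalois ℚ F] (ι₁ : F →+* ℂ)
    (Jstar : Matrix (Fin 2) (Fin 2) F) (hJ : (Jstar.map (IsCMField.complexConj F))ᵀ = Jstar) (hJu : IsUnit Jstar)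
    (K₀ : C5.OpenCompactSubgroup (GSAdele F Jstar)) (S : RecordSystemGS F Jstar ι₁ K₀) (Kc : C5.SmallLevel K₀)
    (Φ : Set (F →+* ℂ)) (hΦ : IsCMTypeThrough ι₁ Φ) :
    ∃ (g : ℕ) (δ : Fin g → ℕ) (b : GSAdele F Jstar →* ↥(gspFinAdelic δ)) (k₀ : ℕ),
      Continuous b ∧ Kc.1.1 ≤ (principalLevelSubgroup δ 1).comap b ∧
      ∀ k : ℕ, k₀ ≤ k → ∀ (Kc'' : C5.SmallLevel K₀),
        Kc''.1.1 = Kc.1.1 ⊓ (principalLevelSubgroup δ (3 * (k + 1).factorial)).comap b →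
    (∀ u ∈ Kc.1.1, C5.HeckeLE u Kc'' Kc'') ∧
    ∃ (Fi₀ : Type) (_ : Field Fi₀) (_ : NumberField Fi₀) (_ : Algebra F Fi₀) (_ : IsGalois F Fi₀) (τ₀ : Fi₀ →+* ℂ),
      τ₀.comp (algebraMap F Fi₀) = ι₁ ∧
      ∀ (Fi : Type) [Field Fi] [NumberField Fi] [Algebra F Fi] [IsGalois F Fi] (τE : Fi →+* ℂ) (j : Fi₀ →ₐ[F] Fi),
        τE.comp (j : Fi₀ →+* Fi) = τ₀ → Nonempty (PELWitnessE F ι₁ Jstar K₀ S Kc'' Fi τE Φ) := by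
  -- E1+E2+E3: the frame `b`, the depth `k₀`; below it, per deep saturated level, the slice field and, over every larger slice field, the chart
  obtain ⟨g, δ, b, k₀, hbcont, hb1, hdeep⟩ := stub_E123 F ι₁ Jstar hJ hJu K₀ S Kc Φ hΦ (stub_SIG F ι₁ Jstar hJ hJu K₀ S Kc)
  refine ⟨g, δ, b, k₀, hbcont, hb1, fun k hk Kc'' hKc'' => ⟨fun u hu x hx => ?_, ?_⟩⟩
  · -- `Kc'' = Kc ⊓ b⁻¹K_δ(N)` is NORMAL in `Kc`: `b(Kc) ⊆ K_δ(1)` normalises `K_δ(N)` (★ `principalLevelSubgroup_normal_in_one`)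
    rw [hKc''] at hx ⊢
    refine ⟨Subgroup.mul_mem _ (Subgroup.mul_mem _ (Subgroup.inv_mem _ hu) hx.1) hu, ?_⟩
    have h := principalLevelSubgroup_normal_in_one δ (3 * (k + 1).factorial) (Subgroup.inv_mem _ (hb1 hu)) hx.2
    rw [inv_inv] at h
    change b (u⁻¹ * x * u) ∈ principalLevelSubgroup δ (3 * (k + 1).factorial)
    rw [map_mul, map_mul, map_inv]
    exact h
  obtain ⟨Fi₀, _, _, _, _, τ₀, hτ₀, hchart⟩ := hdeep k hk Kc'' hKc''
  refine ⟨Fi₀, ‹_›, ‹_›, ‹_›, ‹_›, τ₀, hτ₀, fun Fi _ _ _ _ τE j hj => ?_⟩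
  obtain ⟨C⟩ := hchart Fi τE j hj
  -- `τE` extends `ι₁` (through `j` and `τ₀`)
  have hτE : τE.comp (algebraMap F Fi) = ι₁ := by
    rw [← j.comp_algebraMap, ← RingHom.comp_assoc, hj, hτ₀]
  -- E4: the complex morphism inducing the point map
  have hψ := stub_E4 F ι₁ Jstar hJ hJu K₀ S Kc'' Fi τE hτE Φ C
  -- E5: descent to the slice field
  obtain ⟨ε, hε⟩ := stub_E5 F ι₁ Jstar hJ hJu K₀ S Kc'' Fi τE hτE Φ C hψ
  -- `sep`: `ε` is injective on complex points because the chart՚s point map is (★ p847435 over `C.f_injective`)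
  have hsep := RecordSystemGS.algPoints_map_injective_of_sliceDescent S Kc'' C.𝓜.M C.f τE hτE ε hε C.f_injective
  -- E6: the tuple and the action
  obtain ⟨P, G, Ĝ, hP, ρ, hros, hkot⟩ := stub_E6 F ι₁ Jstar hJ hJu K₀ S Kc'' Fi τE hτE Φ hΦ C ε hε
      Literature.AlgebraicGeometry.ModuliOfAbelianVarieties.siegelUniversalFamilyUniformisation_holds
  exact ⟨{
    g := C.g, N := C.N, δ := C.δ, hδN := ⟨C.hδ, C.hN⟩, P := P, hg := C.g_eq, 𝓜 := C.𝓜, ε := ε, G := G, Ĝ := Ĝ, isBaseChange := hP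
    sep := hsep, ρ := ρ, rosati := hros, kottwitz := hkot }⟩

end Summit.HodgeConjecture.HodgeConjecture.Cruxes.HLiu418.F0P6aPELWitnessE

end
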